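/- Width seat `ym-line-sfw-p2-w5` (prover-ym-line-sfw-p2-w5-g18-0), free hands for planner ym-idea-2's STUB-PLAN-E (LINE-17 on crux
`AllWindowsColdBox.BoxMidWindowsSU22` = stmt-QuantumFields-24003, stub E `stub_tiltMoments`): E(1) ∘ E(2) ∘ E(3) assembled — the Gaussian
second moment of the cubic part of the tilt. -/
import Summits.QuantumFields.YangMills.Theorems.AllWindowsColdBoxTiltCubicGram
import Summits.QuantumFields.YangMills.Theorems.AllWindowsColdBoxCubicChaosVarianceBound
import Summits.QuantumFields.YangMills.Theorems.AllWindowsColdBoxGaussDCoordinateProcess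
import Summits.QuantumFields.YangMills.Theorems.AllWindowsColdBoxPiMultivariateGaussianHypercontractivity
import Summits.QuantumFields.YangMills.Theorems.WeakCouplingRatesColdBoxLargeFieldSU2

/-!
# `E_γ[tiltCubicW²] ≤ 216·D³·(16H)²·#(plaquettes touching Λ)/β` — the variance of the cubic part of the tilt (STUB-PLAN-E, E(2)+E(3) assembled)

The three bricks of STUB-PLAN-E §2 for the cubic chaos `V₃` of LINE-17's tilt are composed here, under the Gaussian reference
`γ = gaussD H D` (`D = dimE ρ`), for `H ≥ 1` and `β > 0`:

* E(1) (`AllWindowsColdBoxTiltCubicForm`): `tiltCubicW ρ H β t = (√β)⁻¹·Σ_{abc} B_{abc}·X_aX_bX_c`, `B = tiltCubicTensor ρ H` TRACE-FREE against every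
  colour-block-diagonal kernel;
* E(2) (`AllWindowsColdBoxCubicChaosVarianceBound`, seat w5 g17): `E[(Σ B·XXX)²] ≤ 6·Σ BB'·C_{aa'}C_{bb'}C_{cc'}` for a centred Gaussian process with
  positive semidefinite two-point matrix `C` and trace-free `B`;
* the instance (`AllWindowsColdBoxGaussDCoordinateProcess`, seat w2 g27): the coordinates of `γ` are a centred Gaussian process with two-point matrix
  `1 ⊗ₖ Q_D⁻¹` (`coordKernel`, positive semidefinite by `PosSemidef.kronecker`) and `|(Q_D⁻¹)_{ef}| ≤ 16H`;
* E(3) (`AllWindowsColdBoxTiltCubicGram`): `Σ BB'ΓΓΓ ≤ 36·D³·M²·#touching`.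

Results: **`integral_cubicForm_tilt_sq_le`** (`E_γ[(Σ B·XXX)²] ≤ 6·36·D³·(16H)²·#touching`) and **`integral_tiltCubicW_sq_le`**
(`E_γ[tiltCubicW²] ≤ 216·D³·(16H)²·#touching/β`; with `#touching ≍ H⁴` this is the planner's `Var(V₃) ≤ K₃H⁶/β`, exponent 6 as measured by I17);
and E(5) for `V₃`: the cubic form is the evaluation of an `MvPolynomial` of total degree `≤ 3` in the coordinates (`exists_mvPolynomial_tiltCubic`),
so HYPERCONTRACTIVITY (`GaussHypercontractivity.pi_multivariateGaussian_bonami`, seat w5 g17) gives ALL even moments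
**`integral_tiltCubicW_pow_even_le`**: `E_γ[tiltCubicW^{2k}] ≤ (2k−1)^{3k}·(216·D³·(16H)²·#touching/β)^k` (`k ≥ 1`) — the moment shape consumed by
the capped exponential moment bound of E(7) (`m = 3`), and at `k = 4` the `V₃`-term of the FIRST CLAUSE of `TiltMoments` under `γ`
(STUB-PLAN-E §2 E(5)/E(6)).
Plus the integrability inputs of E(7)/E(8): `integrable_cubicForm_tilt_pow`, `integrable_tiltCubicW_pow` (all powers, `GaussianWick.integrable_prod`),
`aestronglyMeasurable_tiltCubicW`.  Everything proved; no definition; standard axioms.  HONEST LABEL: helper toward the open registered stub E of a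
critic-passed line on the R2ξ″ RECORD-rung crux 24003; no stub is proved by name, no crux, rung or summit is proved; the Yang–Mills mass gap is NOT proved by this file.
-/

set_option autoImplicit false

noncomputable section

open MeasureTheory Finset Matrix
open scoped Kronecker
open Literature.Probability.LatticeModels (Site halfOpenBox)
open Literature.MathematicalPhysics.QuantumLattice
open Literature.MathematicalPhysics.QuantumFieldTheory
open Literature.MathematicalPhysics.QuantumFieldTheory.LatticeMaxwell
open Literature.MathematicalPhysics.QuantumFieldTheory.AxialGauge
open Summit.QuantumFields.YangMills.Theorems.WeakCouplingRates
open Summit.QuantumFields.YangMills.Theorems.FreeEnergyLogCoefficient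
open Summit.QuantumFields.YangMills.Theorems.AllWindowsColdBox

namespace Summit.QuantumFields.YangMills.Theorems.ColdBoxAllGroups

variable {N : ℕ} {G : Type*} [Group G] (ρ : G →* Matrix (Fin N) (Fin N) ℂ) {H : ℕ}

/-- The two-point matrix of the coordinate process of `gaussD H D` on the legs `Fin D × DirFree H`: `1 ⊗ₖ Q_D⁻¹`. -/
theorem coordKernel_apply (a b : Fin (dimE ρ) × DirFree H) :
    ((1 : Matrix (Fin (dimE ρ)) (Fin (dimE ρ)) ℝ) ⊗ₖ (Qmat (fun e => e ∉ dirFreeEdges H) dirCorner (2 * H + 3))⁻¹) a b =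
      if a.1 = b.1 then (Qmat (fun e => e ∉ dirFreeEdges H) dirCorner (2 * H + 3))⁻¹ a.2 b.2 else 0 := by
  rw [Matrix.kroneckerMap_apply, Matrix.one_apply]
  split_ifs <;> simp

/-- `1 ⊗ₖ Q_D⁻¹` is positive semidefinite. -/
theorem coordKernel_posSemidef :
    ((1 : Matrix (Fin (dimE ρ)) (Fin (dimE ρ)) ℝ) ⊗ₖ (Qmat (fun e => e ∉ dirFreeEdges H) dirCorner (2 * H + 3))⁻¹).PosSemidef :=
  Matrix.PosSemidef.one.kronecker (posSemidef_dirQmat_inv H)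

/-- **Second Gaussian moment of the cubic form of the tilt**: for `H ≥ 1`,
`E_γ[(Σ_{abc} B_{abc}·X_aX_bX_c)²] ≤ 6·(36·D³·(16H)²·#(plaquettesTouching Λ))` (E(2) third-chaos contraction with the trace-free `B` of E(1), the
coordinate process of seat w2, and the Gram bound E(3) with `M = 16H`). -/
theorem integral_cubicForm_tilt_sq_le (hH : 1 ≤ H) :
    ∫ t, (∑ a : Fin (dimE ρ) × DirFree H, ∑ b : Fin (dimE ρ) × DirFree H, ∑ c : Fin (dimE ρ) × DirFree H,
        tiltCubicTensor ρ H a b c * (t a.1 a.2 * t b.1 b.2 * t c.1 c.2)) ^ 2 ∂(gaussD H (dimE ρ)) ≤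
      6 * (36 * (dimE ρ : ℝ) ^ 3 * (16 * (H : ℝ)) ^ 2 * #(plaquettesTouching (boxEdges 4 (2 * H + 1)))) := by
  classical
  set C : Matrix (Fin (dimE ρ) × DirFree H) (Fin (dimE ρ) × DirFree H) ℝ :=
    (1 : Matrix (Fin (dimE ρ)) (Fin (dimE ρ)) ℝ) ⊗ₖ (Qmat (fun e => e ∉ dirFreeEdges H) dirCorner (2 * H + 3))⁻¹ with hCdef
  have hCapply : ∀ a b : Fin (dimE ρ) × DirFree H,
      C a b = if a.1 = b.1 then (Qmat (fun e => e ∉ dirFreeEdges H) dirCorner (2 * H + 3))⁻¹ a.2 b.2 else 0 :=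
    coordKernel_apply ρ
  have hC : C.PosSemidef := coordKernel_posSemidef ρ
  have hX := AllWindowsColdBoxBoxMidLine.isGaussianProcess_coord_gaussD H (dimE ρ)
  have h0 := AllWindowsColdBoxBoxMidLine.integral_coord_gaussD H (dimE ρ)
  have hCX : ∀ a b : Fin (dimE ρ) × DirFree H, C a b =
      ∫ t, WithLp.ofLp (t (id a).1) (id a).2 * WithLp.ofLp (t (id b).1) (id b).2 ∂(gaussD H (dimE ρ)) := fun a b => by
    rw [hCapply, id, id, AllWindowsColdBoxBoxMidLine.integral_coord_mul_coord_gaussD]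
  have hoff : ∀ a b : Fin (dimE ρ) × DirFree H, a.1 ≠ b.1 → C a b = 0 := fun a b h => by rw [hCapply, if_neg h]
  have h2 := CubicChaos.integral_cubicForm_sq_le hX h0 id C hC hCX (tiltCubicTensor ρ H)
    (sum_sum_tiltCubicTensor_mul_eq_zero₁₂ ρ hoff) (sum_sum_tiltCubicTensor_mul_eq_zero₁₃ ρ hoff)
    (sum_sum_tiltCubicTensor_mul_eq_zero₂₃ ρ hoff)
  have h3 := sum6_tiltCubicTensor_le ρ (fun a b => C a b) hCapply (AllWindowsColdBoxBoxMidLine.abs_covQ_le hH)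
  simp only [id] at h2
  exact h2.trans (mul_le_mul_of_nonneg_left h3 (by norm_num))

/-- **Variance of the cubic part of the tilt under the Gaussian reference**: for `H ≥ 1` and `β > 0`,
`∫ tiltCubicW ρ H β t ² dγ ≤ 216·(dimE ρ)³·(16H)²·#(plaquettesTouching Λ)/β` (E(1): `tiltCubicW = (√β)⁻¹·Σ B·XXX`, then
`integral_cubicForm_tilt_sq_le`).  `tiltCubicW` is odd in `t`, so this second moment IS its variance under the symmetric `γ`. -/
theorem integral_tiltCubicW_sq_le (hH : 1 ≤ H) {β : ℝ} (hβ : 0 < β) :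
    ∫ t, tiltCubicW ρ H β t ^ 2 ∂(gaussD H (dimE ρ)) ≤
      216 * (dimE ρ : ℝ) ^ 3 * (16 * (H : ℝ)) ^ 2 * #(plaquettesTouching (boxEdges 4 (2 * H + 1))) / β := by
  have hc : (Real.sqrt β)⁻¹ ^ 2 = β⁻¹ := by rw [inv_pow, Real.sq_sqrt hβ.le]
  rw [integral_congr_ae (ae_of_all _ fun t => show tiltCubicW ρ H β t ^ 2 = β⁻¹ *
      (∑ a : Fin (dimE ρ) × DirFree H, ∑ b : Fin (dimE ρ) × DirFree H, ∑ c : Fin (dimE ρ) × DirFree H,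
        tiltCubicTensor ρ H a b c * (t a.1 a.2 * t b.1 b.2 * t c.1 c.2)) ^ 2 from by
      rw [tiltCubicW_eq_inv_sqrt_mul_cubicForm ρ hβ, mul_pow, hc]), integral_const_mul]
  calc β⁻¹ * ∫ t, (∑ a : Fin (dimE ρ) × DirFree H, ∑ b : Fin (dimE ρ) × DirFree H, ∑ c : Fin (dimE ρ) × DirFree H,
          tiltCubicTensor ρ H a b c * (t a.1 a.2 * t b.1 b.2 * t c.1 c.2)) ^ 2 ∂(gaussD H (dimE ρ))
      ≤ β⁻¹ * (6 * (36 * (dimE ρ : ℝ) ^ 3 * (16 * (H : ℝ)) ^ 2 * #(plaquettesTouching (boxEdges 4 (2 * H + 1))))) :=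
        mul_le_mul_of_nonneg_left (integral_cubicForm_tilt_sq_le ρ hH) (inv_nonneg.2 hβ.le)
    _ = 216 * (dimE ρ : ℝ) ^ 3 * (16 * (H : ℝ)) ^ 2 * #(plaquettesTouching (boxEdges 4 (2 * H + 1))) / β := by ring

/-! ## E(5) for `V₃`: the eighth moment by hypercontractivity -/

/-- **The cubic form of the tilt is a polynomial of total degree `≤ 3` in the coordinates** (the input shape of
`GaussHypercontractivity.pi_multivariateGaussian_bonami`). -/
theorem exists_mvPolynomial_tiltCubic :
    ∃ P : MvPolynomial (Fin (dimE ρ) × DirFree H) ℝ, P.totalDegree ≤ 3 ∧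
      ∀ t : TSpaceD H (dimE ρ), MvPolynomial.eval (fun v : Fin (dimE ρ) × DirFree H => WithLp.ofLp (t v.1) v.2) P =
        ∑ a : Fin (dimE ρ) × DirFree H, ∑ b : Fin (dimE ρ) × DirFree H, ∑ c : Fin (dimE ρ) × DirFree H,
          tiltCubicTensor ρ H a b c * (t a.1 a.2 * t b.1 b.2 * t c.1 c.2) := by
  classical
  refine ⟨∑ a : Fin (dimE ρ) × DirFree H, ∑ b : Fin (dimE ρ) × DirFree H, ∑ c : Fin (dimE ρ) × DirFree H,
    MvPolynomial.C (tiltCubicTensor ρ H a b c) * (MvPolynomial.X a * MvPolynomial.X b * MvPolynomial.X c), ?_, ?_⟩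
  · refine (MvPolynomial.totalDegree_finsetSum _ _).trans (Finset.sup_le fun a _ => ?_)
    refine (MvPolynomial.totalDegree_finsetSum _ _).trans (Finset.sup_le fun b _ => ?_)
    refine (MvPolynomial.totalDegree_finsetSum _ _).trans (Finset.sup_le fun c _ => ?_)
    refine (MvPolynomial.totalDegree_mul _ _).trans ?_
    rw [MvPolynomial.totalDegree_C, zero_add]
    refine (MvPolynomial.totalDegree_mul _ _).trans ?_
    refine (add_le_add ((MvPolynomial.totalDegree_mul _ _).trans
      (add_le_add (MvPolynomial.totalDegree_X _).le (MvPolynomial.totalDegree_X _).le)) (MvPolynomial.totalDegree_X _).le).trans ?_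
    norm_num
  · intro t
    simp only [map_sum, map_mul, MvPolynomial.eval_C, MvPolynomial.eval_X]

/-- **Even Gaussian moments of the cubic form of the tilt** by hypercontractivity (degree `3`): for `k ≥ 1`,
`E_γ[(Σ B·XXX)^{2k}] ≤ (2k−1)^{3k}·(6·36·D³·(16H)²·#(plaquettesTouching Λ))^k`. -/
theorem integral_cubicForm_tilt_pow_even_le (hH : 1 ≤ H) (k : ℕ) (hk : 1 ≤ k) :
    ∫ t, (∑ a : Fin (dimE ρ) × DirFree H, ∑ b : Fin (dimE ρ) × DirFree H, ∑ c : Fin (dimE ρ) × DirFree H,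
        tiltCubicTensor ρ H a b c * (t a.1 a.2 * t b.1 b.2 * t c.1 c.2)) ^ (2 * k) ∂(gaussD H (dimE ρ)) ≤
      (2 * k - 1 : ℝ) ^ (k * 3) * (6 * (36 * (dimE ρ : ℝ) ^ 3 * (16 * (H : ℝ)) ^ 2 * #(plaquettesTouching (boxEdges 4 (2 * H + 1))))) ^ k := by
  classical
  obtain ⟨P, hP, hPe⟩ := exists_mvPolynomial_tiltCubic ρ (H := H)
  have hb : ∫ t, (MvPolynomial.eval (fun v : Fin (dimE ρ) × DirFree H => WithLp.ofLp (t v.1) v.2) P) ^ (2 * k) ∂(gaussD H (dimE ρ)) ≤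
      (2 * k - 1 : ℝ) ^ (k * 3) *
        (∫ t, (MvPolynomial.eval (fun v : Fin (dimE ρ) × DirFree H => WithLp.ofLp (t v.1) v.2) P) ^ 2 ∂(gaussD H (dimE ρ))) ^ k :=
    GaussHypercontractivity.pi_multivariateGaussian_bonami (κ := Fin (dimE ρ))
      ((Qmat (fun e => e ∉ dirFreeEdges H) dirCorner (2 * H + 3))⁻¹) 3 P hP k hk
  simp only [hPe] at hb
  have h2 := integral_cubicForm_tilt_sq_le ρ hH
  have h0 : 0 ≤ ∫ t, (∑ a : Fin (dimE ρ) × DirFree H, ∑ b : Fin (dimE ρ) × DirFree H, ∑ c : Fin (dimE ρ) × DirFree H,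
      tiltCubicTensor ρ H a b c * (t a.1 a.2 * t b.1 b.2 * t c.1 c.2)) ^ 2 ∂(gaussD H (dimE ρ)) :=
    integral_nonneg fun t => sq_nonneg _
  have hk0 : (0 : ℝ) ≤ (2 * k - 1 : ℝ) ^ (k * 3) := by
    refine pow_nonneg ?_ _
    have : (1 : ℝ) ≤ k := by exact_mod_cast hk
    linarith
  exact hb.trans (mul_le_mul_of_nonneg_left (pow_le_pow_left₀ h0 h2 k) hk0)

/-- **E(5) for the cubic part of the tilt — all even moments**: for `H ≥ 1`, `β > 0` and `k ≥ 1`,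
`∫ tiltCubicW ρ H β t ^{2k} dγ ≤ (2k−1)^{3k}·(216·(dimE ρ)³·(16H)²·#(plaquettesTouching Λ)/β)^k` — exactly the moment shape
`E[X^{2k}] ≤ (2k−1)^{km}·s^k` (`m = 3`, `s = 216·D³·(16H)²·#touching/β`) consumed by the capped exponential moment bound
`CappedExpMoment.setIntegral_exp_mul_abs_le_of_moments` (seat w2, E(7)); `k = 4` is the `V₃`-term of the first clause of `TiltMoments`. -/
theorem integral_tiltCubicW_pow_even_le (hH : 1 ≤ H) {β : ℝ} (hβ : 0 < β) (k : ℕ) (hk : 1 ≤ k) :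
    ∫ t, tiltCubicW ρ H β t ^ (2 * k) ∂(gaussD H (dimE ρ)) ≤
      (2 * k - 1 : ℝ) ^ (k * 3) *
        (216 * (dimE ρ : ℝ) ^ 3 * (16 * (H : ℝ)) ^ 2 * #(plaquettesTouching (boxEdges 4 (2 * H + 1))) / β) ^ k := by
  have hc : (Real.sqrt β)⁻¹ ^ (2 * k) = (β ^ k)⁻¹ := by
    rw [inv_pow, pow_mul, Real.sq_sqrt hβ.le]
  rw [integral_congr_ae (ae_of_all _ fun t => show tiltCubicW ρ H β t ^ (2 * k) = (β ^ k)⁻¹ *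
      (∑ a : Fin (dimE ρ) × DirFree H, ∑ b : Fin (dimE ρ) × DirFree H, ∑ c : Fin (dimE ρ) × DirFree H,
        tiltCubicTensor ρ H a b c * (t a.1 a.2 * t b.1 b.2 * t c.1 c.2)) ^ (2 * k) from by
      rw [tiltCubicW_eq_inv_sqrt_mul_cubicForm ρ hβ, mul_pow, hc]), integral_const_mul]
  have hβk : 0 < β ^ k := pow_pos hβ k
  calc (β ^ k)⁻¹ * ∫ t, (∑ a : Fin (dimE ρ) × DirFree H, ∑ b : Fin (dimE ρ) × DirFree H, ∑ c : Fin (dimE ρ) × DirFree H,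
          tiltCubicTensor ρ H a b c * (t a.1 a.2 * t b.1 b.2 * t c.1 c.2)) ^ (2 * k) ∂(gaussD H (dimE ρ))
      ≤ (β ^ k)⁻¹ * ((2 * k - 1 : ℝ) ^ (k * 3) *
          (6 * (36 * (dimE ρ : ℝ) ^ 3 * (16 * (H : ℝ)) ^ 2 * #(plaquettesTouching (boxEdges 4 (2 * H + 1))))) ^ k) :=
        mul_le_mul_of_nonneg_left (integral_cubicForm_tilt_pow_even_le ρ hH k hk) (inv_nonneg.2 hβk.le)
    _ = _ := by rw [div_pow]; field_simp; ring

/-! ## Integrability of all powers (input `hint` of the capped exponential moment bound of E(7)) -/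

/-- **All powers of the cubic form of the tilt are `γ`-integrable** (finite sums of products of `3n` Gaussian coordinates,
`GaussianWick.integrable_prod`). -/
theorem integrable_cubicForm_tilt_pow (n : ℕ) :
    Integrable (fun t : TSpaceD H (dimE ρ) => (∑ a : Fin (dimE ρ) × DirFree H, ∑ b : Fin (dimE ρ) × DirFree H,
      ∑ c : Fin (dimE ρ) × DirFree H, tiltCubicTensor ρ H a b c * (t a.1 a.2 * t b.1 b.2 * t c.1 c.2)) ^ n) (gaussD H (dimE ρ)) := by
  classical
  have hX := AllWindowsColdBoxBoxMidLine.isGaussianProcess_coord_gaussD H (dimE ρ)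
  -- flatten the triple sum to one sum over leg triples
  have hS : ∀ t : TSpaceD H (dimE ρ), (∑ a : Fin (dimE ρ) × DirFree H, ∑ b : Fin (dimE ρ) × DirFree H,
      ∑ c : Fin (dimE ρ) × DirFree H, tiltCubicTensor ρ H a b c * (t a.1 a.2 * t b.1 b.2 * t c.1 c.2)) =
      ∑ p : (Fin (dimE ρ) × DirFree H) × (Fin (dimE ρ) × DirFree H) × (Fin (dimE ρ) × DirFree H),
        tiltCubicTensor ρ H p.1 p.2.1 p.2.2 * (t p.1.1 p.1.2 * t p.2.1.1 p.2.1.2 * t p.2.2.1 p.2.2.2) := fun t => by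
    simp only [Fintype.sum_prod_type]
  simp_rw [hS, Finset.sum_pow']
  refine integrable_finsetSum _ fun g _ => ?_
  simp_rw [Finset.prod_mul_distrib]
  refine Integrable.const_mul ?_ _
  -- the product of the `3n` coordinates, indexed by `Fin n × Fin 3`
  have h := Literature.Probability.Distributions.GaussianWick.integrable_prod hX (Finset.univ : Finset (Fin n × Fin 3))
    (fun ij => ![(g ij.1).1, (g ij.1).2.1, (g ij.1).2.2] ij.2)
  refine h.congr (ae_of_all _ fun t => ?_)
  dsimp only
  rw [Fintype.prod_prod_type]
  simp only [Fin.prod_univ_three, Matrix.cons_val_zero, Matrix.cons_val_one, Matrix.cons_val_two, Matrix.head_cons,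
    Matrix.tail_cons, Finset.prod_mul_distrib]

/-- **All powers of the cubic part of the tilt are `γ`-integrable** (`β > 0`). -/
theorem integrable_tiltCubicW_pow {β : ℝ} (hβ : 0 < β) (n : ℕ) :
    Integrable (fun t : TSpaceD H (dimE ρ) => tiltCubicW ρ H β t ^ n) (gaussD H (dimE ρ)) := by
  have hfun : (fun t : TSpaceD H (dimE ρ) => tiltCubicW ρ H β t ^ n) = fun t => (Real.sqrt β)⁻¹ ^ n *
      (∑ a : Fin (dimE ρ) × DirFree H, ∑ b : Fin (dimE ρ) × DirFree H, ∑ c : Fin (dimE ρ) × DirFree H,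
        tiltCubicTensor ρ H a b c * (t a.1 a.2 * t b.1 b.2 * t c.1 c.2)) ^ n := by
    funext t
    rw [tiltCubicW_eq_inv_sqrt_mul_cubicForm ρ hβ, mul_pow]
  rw [hfun]
  exact (integrable_cubicForm_tilt_pow ρ n).const_mul _

/-- The cubic part of the tilt is a.e. strongly measurable under `γ` (`β > 0`). -/
theorem aestronglyMeasurable_tiltCubicW {β : ℝ} (hβ : 0 < β) :
    AEStronglyMeasurable (tiltCubicW ρ H β) (gaussD H (dimE ρ)) := by
  have h := integrable_tiltCubicW_pow ρ (H := H) hβ 1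
  simp only [pow_one] at h
  exact h.aestronglyMeasurable

/-! ## The `V₃` package in the shape consumed by the E(8) assembly (seat w2 g28, 10:40Z) -/

/-- **The `V₃` moment package**: one constant `K₁ = 1658880·(dimE ρ)³` such that for all `H ≥ 1`, `β > 0`:
all even `γ`-moments `∫ tiltCubicW^{2k} dγ ≤ (2k−1)^{3k}·(K₁·(2H+3)⁶/β)^k` (`k ≥ 1`) and all even powers are `γ`-integrable
(`#(plaquettesTouching Λ) ≤ 120(2H+1)⁴`, `(16H)² ≤ 64(2H+3)²`). -/
theorem tiltCubicW_moment_package :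
    ∃ K₁ : ℝ, 0 ≤ K₁ ∧ ∀ (H : ℕ) (β : ℝ), 1 ≤ H → 0 < β →
      (∀ k : ℕ, 1 ≤ k → ∫ t, tiltCubicW ρ H β t ^ (2 * k) ∂(gaussD H (dimE ρ)) ≤
          (2 * k - 1 : ℝ) ^ (k * 3) * (K₁ * (2 * (H : ℝ) + 3) ^ 6 / β) ^ k) ∧
        ∀ k : ℕ, Integrable (fun t : TSpaceD H (dimE ρ) => tiltCubicW ρ H β t ^ (2 * k)) (gaussD H (dimE ρ)) := by
  have hD3 : (0 : ℝ) ≤ (dimE ρ : ℝ) ^ 3 := pow_nonneg (Nat.cast_nonneg _) 3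
  refine ⟨1658880 * (dimE ρ : ℝ) ^ 3, mul_nonneg (by norm_num) hD3, fun H β hH hβ =>
    ⟨fun k hk => ?_, fun k => integrable_tiltCubicW_pow ρ hβ (2 * k)⟩⟩
  refine (integral_tiltCubicW_pow_even_le ρ hH hβ k hk).trans ?_
  have hk0 : (0 : ℝ) ≤ (2 * k - 1 : ℝ) ^ (k * 3) := by
    refine pow_nonneg ?_ _
    have : (1 : ℝ) ≤ k := by exact_mod_cast hk
    linarith
  have hs0 : 0 ≤ 216 * (dimE ρ : ℝ) ^ 3 * (16 * (H : ℝ)) ^ 2 * #(plaquettesTouching (boxEdges 4 (2 * H + 1))) / β :=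
    div_nonneg (mul_nonneg (mul_nonneg (mul_nonneg (by norm_num) hD3) (sq_nonneg _)) (Nat.cast_nonneg _)) hβ.le
  refine mul_le_mul_of_nonneg_left (pow_le_pow_left₀ hs0 ?_ k) hk0
  -- `216·D³·(16H)²·#touching ≤ 1658880·D³·(2H+3)⁶`
  have hTP : (#(plaquettesTouching (boxEdges 4 (2 * H + 1))) : ℝ) ≤ 120 * (2 * (H : ℝ) + 1) ^ 4 := by
    have h := card_plaquettesTouching_boxEdges_le (2 * H + 1)
    have h' : ((#(plaquettesTouching (boxEdges 4 (2 * H + 1))) : ℕ) : ℝ) ≤ ((120 * (2 * H + 1) ^ 4 : ℕ) : ℝ) := by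
      exact_mod_cast h
    push_cast at h'
    exact h'
  have hH0 : (0 : ℝ) ≤ H := Nat.cast_nonneg H
  have h16 : (16 * (H : ℝ)) ^ 2 ≤ 64 * (2 * (H : ℝ) + 3) ^ 2 := by nlinarith
  have h4 : (2 * (H : ℝ) + 1) ^ 4 ≤ (2 * (H : ℝ) + 3) ^ 4 := pow_le_pow_left₀ (by positivity) (by linarith) 4
  have hprod : (16 * (H : ℝ)) ^ 2 * (#(plaquettesTouching (boxEdges 4 (2 * H + 1))) : ℝ) ≤
      64 * (2 * (H : ℝ) + 3) ^ 2 * (120 * (2 * (H : ℝ) + 3) ^ 4) :=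
    mul_le_mul h16 (hTP.trans (by nlinarith [h4])) (Nat.cast_nonneg _) (by positivity)
  have hD : (0 : ℝ) ≤ 216 * (dimE ρ : ℝ) ^ 3 := mul_nonneg (by norm_num) hD3
  rw [div_le_div_iff_of_pos_right hβ]
  calc 216 * (dimE ρ : ℝ) ^ 3 * (16 * (H : ℝ)) ^ 2 * #(plaquettesTouching (boxEdges 4 (2 * H + 1)))
      = 216 * (dimE ρ : ℝ) ^ 3 * ((16 * (H : ℝ)) ^ 2 * #(plaquettesTouching (boxEdges 4 (2 * H + 1)))) := by ring
    _ ≤ 216 * (dimE ρ : ℝ) ^ 3 * (64 * (2 * (H : ℝ) + 3) ^ 2 * (120 * (2 * (H : ℝ) + 3) ^ 4)) :=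
        mul_le_mul_of_nonneg_left hprod hD
    _ = 1658880 * (dimE ρ : ℝ) ^ 3 * (2 * (H : ℝ) + 3) ^ 6 := by ring

end Summit.QuantumFields.YangMills.Theorems.ColdBoxAllGroups

end
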